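import Mathlib.Topology.Algebra.InfiniteSum.Order
import Mathlib.Topology.Algebra.InfiniteSum.Real
import Mathlib.Tactic.Linarith
import HarnessLib

/-!
# Thermal versus time-periodic torus denominators: the supertrace return estimate
(stub `stub_denominator_comparison` of line `twisted_trace_transfer` for crux
`QuarksAsStableAction.StableActionBridge`, item stmt-QuantumFields-9737, §8 E3)

In step E3 of the line, `λᵢ ≥ 0` are the eigenvalues of lattice QCD's positive transfer operator,
`σᵢ = ±1` the fermion parities of a parity-adapted eigenbasis and `i₀` the (even) vacuum index; the
THERMAL torus denominator is the trace `Z_th = Σᵢ λᵢ^N` and the time-PERIODIC one is the supertrace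
`Z_tw = Σᵢ σᵢ λᵢ^N`.  This abstract lemma is the first return estimate at the operator level:

* `λ_{i₀}^N ≤ Z_th` (a single non-negative term is bounded by the unconditional sum, `le_hasSum`);
* `|Z_tw − Z_th| ≤ 2 (Z_th − λ_{i₀}^N)` and `λ_{i₀}^N − (Z_th − λ_{i₀}^N) ≤ Z_tw`.

Proof of the last two: termwise `σᵢ λᵢ^N ≤ λᵢ^N`, so `Z_tw ≤ Z_th` (`hasSum_le`); termwise
`0 ≤ λᵢ^N + σᵢ λᵢ^N`, and the `i₀` term of `Z_th + Z_tw = Σᵢ (λᵢ^N + σᵢ λᵢ^N)` equals `2 λ_{i₀}^N`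
(`σ_{i₀} = 1`), so `2 λ_{i₀}^N ≤ Z_th + Z_tw` (`le_hasSum` for the `HasSum.add` of the two series).
Hence `|Z_tw − Z_th| = Z_th − Z_tw ≤ 2 Z_th − 2 λ_{i₀}^N` and `Z_tw ≥ 2 λ_{i₀}^N − Z_th`, which are the
two claims.  (The domination hypothesis `λᵢ ≤ λ_{i₀}` is part of the registered signature but is not
used.)  Mathlib only. [folklore]
-/

namespace Summit.QuantumFields.QCD.Cruxes.StableActionBridge.TwistedTraceTransfer

namespace StubDenominatorComparison

/-- For a sign `s = ±1` and `0 ≤ x`: `s * x ≤ x` and `0 ≤ x + s * x`. [folklore] -/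
theorem sign_mul_bounds {s x : ℝ} (hs : s = 1 ∨ s = -1) (hx : 0 ≤ x) :
    s * x ≤ x ∧ 0 ≤ x + s * x := by
  rcases hs with rfl | rfl <;> constructor <;> linarith

end StubDenominatorComparison

open StubDenominatorComparison in
/-- **Supertrace return estimate** (step E3 of line `twisted_trace_transfer`): for non-negative weights
`lam i` (dominated by `lam i₀`), signs `σ i = ±1` with `σ i₀ = 1`, and the unconditional sums
`Zth = Σ lam i ^ N`, `Ztw = Σ σ i * lam i ^ N`, one has `lam i₀ ^ N ≤ Zth`,
`|Ztw - Zth| ≤ 2 * (Zth - lam i₀ ^ N)` and `lam i₀ ^ N - (Zth - lam i₀ ^ N) ≤ Ztw`. [folklore] -/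
theorem stub_denominator_comparison : ∀ (ι : Type) (lam σ : ι → ℝ) (i₀ : ι) (N : ℕ) (Zth Ztw : ℝ),
    (∀ i, 0 ≤ lam i ∧ lam i ≤ lam i₀) → (∀ i, σ i = 1 ∨ σ i = -1) → σ i₀ = 1 →
    HasSum (fun i => lam i ^ N) Zth → HasSum (fun i => σ i * lam i ^ N) Ztw →
    lam i₀ ^ N ≤ Zth ∧ |Ztw - Zth| ≤ 2 * (Zth - lam i₀ ^ N) ∧ lam i₀ ^ N - (Zth - lam i₀ ^ N) ≤ Ztw := by
  intro ι lam σ i₀ N Zth Ztw hlam hσ hσ₀ hZth hZtw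
  have hnn : ∀ i, 0 ≤ lam i ^ N := fun i => pow_nonneg (hlam i).1 N
  -- (1) a single non-negative term is bounded by the unconditional sum
  have h1 : lam i₀ ^ N ≤ Zth := le_hasSum hZth i₀ fun j _ => hnn j
  -- (2) termwise `σ i * lam i ^ N ≤ lam i ^ N`, hence `Ztw ≤ Zth`
  have h2 : Ztw ≤ Zth := by
    refine hasSum_le (fun i => ?_) hZtw hZth
    show σ i * lam i ^ N ≤ lam i ^ N
    exact (sign_mul_bounds (hσ i) (hnn i)).1
  -- (3) termwise `0 ≤ lam i ^ N + σ i * lam i ^ N`; the `i₀` term of `Zth + Ztw` is `2 * lam i₀ ^ N`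
  have h3 : lam i₀ ^ N + σ i₀ * lam i₀ ^ N ≤ Zth + Ztw := by
    refine le_hasSum (hZth.add hZtw) i₀ fun j _ => ?_
    show 0 ≤ lam j ^ N + σ j * lam j ^ N
    exact (sign_mul_bounds (hσ j) (hnn j)).2
  rw [hσ₀, one_mul] at h3
  refine ⟨h1, ?_, ?_⟩
  · rw [abs_sub_comm, abs_of_nonneg (sub_nonneg.mpr h2)]
    linarith
  · linarith

end Summit.QuantumFields.QCD.Cruxes.StableActionBridge.TwistedTraceTransfer
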